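import Summits.MatrixMultiplication.OmegaCensus.STPPKernelListerDataZ59
import Summits.MatrixMultiplication.OmegaCensus.STPPKernelListerSplit


/-!
# ω-census (abelian STPP census): kernel lister rows for `ℤ_59` (split form), file 24 of 43 (kernel computation)

HONEST FRAMING (pub-omega census; verbatim): lottery ticket; floor = certified bounds/negative ranges.
Census STRUCTURE (seat pub-omega-stpp-2 gen 29, 2026-08-29), family (b2).  One chunk of the root computation of the kernel lister at `n = 59` in split form
(`KLister.scanFirstSel2C`): light first blocks (part 1 of 8: 150 shapes), second blocks unrestricted.  Measured ≈ 0.2–1.2 s of kernel per thin first block (the `List.contains` selection itself costs 741·|sel1| comparisons).  Assembled in `STPPKernelListerCapstoneZ59.lean`.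
Pure finite computation; nothing here is progress on `ω`.
-/

namespace Summit.MatrixMultiplication.OmegaCensus.KLister

/-- First blocks of this file. [folklore] -/
def sel1Z59S24P1 : List Shape := [(3, 2, 2), (1, 1, 59), (1, 59, 1), (59, 1, 1), (1, 1, 58), (1, 2, 29), (1, 29, 2), (1, 58, 1), (2, 1, 29), (2, 29, 1), (29, 1, 2), (29, 2, 1), (58, 1, 1), (1, 1, 57), (1, 3, 19), (1, 19, 3), (1, 57, 1), (3, 1, 19), (3, 19, 1), (19, 1, 3), (19, 3, 1), (57, 1, 1), (1, 1, 56), (1, 2, 28), (1, 4, 14), (1, 7, 8), (1, 8, 7), (1, 14, 4), (1, 28, 2), (1, 56, 1), (2, 1, 28), (2, 28, 1), (4, 1, 14), (4, 14, 1), (7, 1, 8), (7, 8, 1), (8, 1, 7), (8, 7, 1), (14, 1, 4), (14, 4, 1), (28, 1, 2), (28, 2, 1), (56, 1, 1), (1, 1, 55), (1, 5, 11), (1, 11, 5), (1, 55, 1), (5, 1, 11), (5, 11, 1), (11, 1, 5), (11, 5, 1), (55, 1, 1), (1, 1, 54), (1, 2, 27), (1, 3, 18), (1, 6, 9), (1,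 9, 6), (1, 18, 3), (1, 27, 2), (1, 54, 1), (2, 1, 27), (2, 27, 1), (3, 1, 18), (3, 18, 1), (6, 1, 9), (6, 9, 1), (9, 1, 6), (9, 6, 1), (18, 1, 3), (18, 3, 1), (27, 1, 2), (27, 2, 1), (54, 1, 1), (1, 1, 53), (1, 53, 1), (53, 1, 1), (1, 1, 52), (1, 2, 26), (1, 4, 13), (1, 13, 4), (1, 26, 2), (1, 52, 1), (2, 1, 26), (2, 26, 1), (4, 1, 13), (4, 13, 1), (13, 1, 4), (13, 4, 1), (26, 1, 2), (26, 2, 1), (52, 1, 1), (1, 1, 51), (1, 3, 17), (1, 17, 3), (1, 51, 1), (3, 1, 17), (3, 17, 1), (17, 1, 3), (17, 3, 1), (51, 1, 1), (1, 1, 50), (1, 2, 25), (1, 5, 10), (1, 10, 5), (1, 25, 2), (1, 50, 1), (2, 1, 25), (2, 25, 1), (5, 1, 10), (5, 10, 1), (10, 1, 5), (10, 5, 1), (25, 1, 2), (25, 2, 1), (50, 1, 1), (1, 1, 49), (1, 7, 7), (1, 49, 1), (7, 1, 7), (7, 7, 1), (49, 1, 1), (1, 1, 48), (1, 2, 24),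 (1, 3, 16), (1, 4, 12), (1, 6, 8), (1, 8, 6), (1, 12, 4), (1, 16, 3), (1, 24, 2), (1, 48, 1), (2, 1, 24), (2, 24, 1), (3, 1, 16), (3, 16, 1), (4, 1, 12), (4, 12, 1), (6, 1, 8), (6, 8, 1), (8, 1, 6), (8, 6, 1), (12, 1, 4), (12, 4, 1), (16, 1, 3), (16, 3, 1), (24, 1, 2), (24, 2, 1), (48, 1, 1), (1, 1, 47), (1, 47, 1)]


set_option maxRecDepth 32768 in
set_option maxHeartbeats 4000000 in
/-- Rows of the kernel lister at `59` (split form) for this file's selections. [folklore] -/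
theorem scanSel_Z59_S24P1 :
    scanFirstSel2C 59 deadZ59 (fun s => sel1Z59S24P1.contains s) (fun _ => true) chunksZ59 = true := by
  decide +kernel

end Summit.MatrixMultiplication.OmegaCensus.KLister
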